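import Mathlib
import Summits.KontsevichZagierPeriods.KontsevichZagierPeriods.Theorems.SoloInformedBlockReps
import HarnessLib
import HarnessLib.Audit

/-!
# SoloInformed — the block labellings of the harmonic product

Solo programme `solo-KontsevichZagierPeriods-informed`, session s47 (PROGRAMME XLVI, file 5;
pure combinatorics).

Coordinates of the product cube `(0,1)^{M+1}`, `M + 1 = (m+1) + (a+2)`: the first `m+1` carry
the word of the index `u = (u₀,…,u_k)` (weight `m+1`), the last `a+2` the word of `(a+2)`.
The `u`-LABEL of a coordinate `l < m+1` is its block, `labU(l) = min {t | l < J_{t+1}}`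
(`soloInformedLabU`).  The terms of the harmonic product `ζ(a+2)·ζ(u)` are indexed by the
labellings

* `LabIns i` (`0 ≤ i ≤ k+1`): `u`-blocks `< i` keep their label, `u`-blocks `≥ i` are shifted by
  one, the `X`-block gets label `i` — index `u.take i ++ (a+2) :: u.drop i`;
* `LabMerge i` (`0 ≤ i ≤ k`): all `u`-blocks keep their label and the `X`-block joins block `i` —
  index `u.take i ++ ((a+2) + u_i) :: u.drop (i+1)`.

This file computes their fibres, validity (`soloInformedIsLab`), indices and chain products
(`Q_t` = `u`-prefix products, times the `X`-product `Y` from the insertion point on), in the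
shape of the entry formulas of `soloInformedInsQ` / `soloInformedMergeQ` (file 2).

References: Hoffman 1997 §2; Hoffman 1992 §2.
-/

noncomputable section

open Literature.NumberTheory.Transcendental
open Literature.NumberTheory.Transcendental.KZ

namespace Summit.KontsevichZagierPeriods.KontsevichZagierPeriods.Theorems

/-! ## 1. Counting coordinates -/

section fin

variable {N : ℕ}

/-- `#{l : Fin N | l < e} = e` for `e ≤ N`. -/
theorem soloInformed_card_filter_val_lt {e : ℕ} (he : e ≤ N) :
    (Finset.univ.filter fun l : Fin N => l.1 < e).card = e := by
  have h : Finset.univ.filter (fun l : Fin N => l.1 < e) =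
      Finset.univ.map ⟨Fin.castLE he, Fin.castLE_injective he⟩ := by
    ext l
    simp only [Finset.mem_filter, Finset.mem_univ, true_and, Finset.mem_map,
      Function.Embedding.coeFn_mk]
    exact ⟨fun hl => ⟨⟨l.1, hl⟩, Fin.ext rfl⟩, fun ⟨i, hi⟩ => hi ▸ i.2⟩
  rw [h, Finset.card_map, Finset.card_univ, Fintype.card_fin]

/-- `#{l : Fin N | b ≤ l} = c` when `b + c = N`. -/
theorem soloInformed_card_filter_le_val {b c : ℕ} (h : b + c = N) :
    (Finset.univ.filter fun l : Fin N => b ≤ l.1).card = c := by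
  have h' : Finset.univ.filter (fun l : Fin N => b ≤ l.1) =
      Finset.univ.map ⟨fun j : Fin c => (⟨b + j.1, by omega⟩ : Fin N),
        fun j j' hj => Fin.ext (by simpa using congrArg Fin.val hj)⟩ := by
    ext l
    simp only [Finset.mem_filter, Finset.mem_univ, true_and, Finset.mem_map,
      Function.Embedding.coeFn_mk]
    constructor
    · intro hl
      exact ⟨⟨l.1 - b, by omega⟩, Fin.ext (by simp only; omega)⟩
    · rintro ⟨j, rfl⟩
      simp
  rw [h', Finset.card_map, Finset.card_univ, Fintype.card_fin]

end fin

/-! ## 2. The `u`-label of a coordinate -/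

section labU

variable {N : ℕ} (u : List ℕ)

/-- Below the weight there is a block end above. -/
theorem soloInformed_exists_lt_ends {j : ℕ} (h : j < u.sum) :
    ∃ t, j < (soloInformedEnds u).getD t 0 := by
  have hne : u ≠ [] := by
    rintro rfl
    simp at h
  obtain ⟨k, hk⟩ : ∃ k, u.length = k + 1 :=
    ⟨u.length - 1, by have := List.length_pos_of_ne_nil hne; omega⟩
  exact ⟨k, by rw [soloInformed_ends_getD_last hk]; exact h⟩

/-- The `u`-label (block number) of a coordinate: the least `t` with `l < J_{t+1}`
(and `0` off the `u`-part). -/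
def soloInformedLabU (l : Fin N) : ℕ :=
  if h : l.1 < u.sum then Nat.find (soloInformed_exists_lt_ends u h) else 0

variable {u} {m k : ℕ} (hpos : ∀ i ∈ u, 1 ≤ i) (hw : u.sum = m + 1) (hk : u.length = k + 1)
include hpos hw hk

/-- **`labU l ≤ t ↔ l < J_{t+1}`.** -/
theorem soloInformed_labU_le_iff {l : Fin N} (hl : l.1 < m + 1) {t : ℕ} (ht : t ≤ k) :
    soloInformedLabU u l ≤ t ↔ l.1 < (soloInformedEnds u).getD t 0 := by
  unfold soloInformedLabU
  rw [dif_pos (by omega), Nat.find_le_iff]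
  exact ⟨fun ⟨t', ht', h⟩ => h.trans_le (soloInformed_ends_getD_le hpos ht' (by omega)),
    fun h => ⟨t, le_rfl, h⟩⟩

/-- Labels of the `u`-part are `≤ k`. -/
theorem soloInformed_labU_le {l : Fin N} (hl : l.1 < m + 1) : soloInformedLabU u l ≤ k :=
  (soloInformed_labU_le_iff hpos hw hk hl le_rfl).2 (by rw [soloInformed_ends_getD_last hk, hw]; exact hl)

/-- Every end is at most the weight. -/
theorem soloInformed_ends_getD_le_weight (t : ℕ) : (soloInformedEnds u).getD t 0 ≤ m + 1 := by
  by_cases ht : t < u.length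
  · rw [← hw, ← soloInformed_ends_getD_last hk]
    exact soloInformed_ends_getD_le hpos (by omega) (by omega)
  · rw [List.getD_eq_default _ _ (by simp only [soloInformed_length_ends]; omega)]
    omega

/-- **The cumulative `u`-set**: `{l < m+1 | labU l ≤ t} = {l | l < J_{t+1}}`. -/
theorem soloInformed_filter_labU_le {t : ℕ} (ht : t ≤ k) :
    Finset.univ.filter (fun l : Fin N => l.1 < m + 1 ∧ soloInformedLabU u l ≤ t) =
      Finset.univ.filter (fun l : Fin N => l.1 < (soloInformedEnds u).getD t 0) := by
  ext l
  simp only [Finset.mem_filter, Finset.mem_univ, true_and]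
  have hle := soloInformed_ends_getD_le_weight hpos hw hk t
  constructor
  · rintro ⟨hl, h⟩
    exact (soloInformed_labU_le_iff hpos hw hk hl ht).1 h
  · intro h
    exact ⟨by omega, (soloInformed_labU_le_iff hpos hw hk (by omega) ht).2 h⟩

/-- The strict cumulative `u`-set: `{l < m+1 | labU l < t}` is empty for `t = 0` and
`{l | l < J_t}` otherwise. -/
theorem soloInformed_filter_labU_lt {t : ℕ} (ht : t ≤ k + 1) :
    Finset.univ.filter (fun l : Fin N => l.1 < m + 1 ∧ soloInformedLabU u l < t) =
      if t = 0 then ∅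
      else Finset.univ.filter (fun l : Fin N => l.1 < (soloInformedEnds u).getD (t - 1) 0) := by
  rcases t with _ | s
  · simp
  · rw [if_neg (Nat.succ_ne_zero s), Nat.add_sub_cancel,
      ← soloInformed_filter_labU_le hpos hw hk (by omega : s ≤ k)]
    ext l
    simp only [Finset.mem_filter, Finset.mem_univ, true_and, Nat.lt_succ_iff]

/-- **The `u`-fibres have the sizes `u_t`.** -/
theorem soloInformed_card_fibreU (hN : m + 1 ≤ N) {t : ℕ} (ht : t ≤ k) :
    (Finset.univ.filter fun l : Fin N => l.1 < m + 1 ∧ soloInformedLabU u l = t).card =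
      u[t]'(by omega) := by
  have hsplit : Finset.univ.filter (fun l : Fin N => l.1 < m + 1 ∧ soloInformedLabU u l ≤ t) =
      Finset.univ.filter (fun l : Fin N => l.1 < m + 1 ∧ soloInformedLabU u l < t) ∪
        Finset.univ.filter (fun l : Fin N => l.1 < m + 1 ∧ soloInformedLabU u l = t) := by
    ext l
    simp only [Finset.mem_filter, Finset.mem_univ, true_and, Finset.mem_union]
    omega
  have hdisj : Disjoint
      (Finset.univ.filter (fun l : Fin N => l.1 < m + 1 ∧ soloInformedLabU u l < t))
      (Finset.univ.filter (fun l : Fin N => l.1 < m + 1 ∧ soloInformedLabU u l = t)) :=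
    Finset.disjoint_filter.2 fun l _ h1 h2 => by omega
  have hc := congrArg Finset.card hsplit
  rw [Finset.card_union_of_disjoint hdisj, soloInformed_filter_labU_le hpos hw hk ht,
    soloInformed_card_filter_val_lt ((soloInformed_ends_getD_le_weight hpos hw hk t).trans hN),
    soloInformed_filter_labU_lt hpos hw hk (by omega : t ≤ k + 1)] at hc
  rcases t with _ | s
  · rw [if_pos rfl, Finset.card_empty, zero_add, soloInformed_ends_getD (by omega),
      List.sum_take_succ _ _ (by omega), List.take_zero, List.sum_nil, zero_add] at hc
    exact hc.symm
  · rw [if_neg (Nat.succ_ne_zero s), Nat.add_sub_cancel,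
      soloInformed_card_filter_val_lt ((soloInformed_ends_getD_le_weight hpos hw hk s).trans hN),
      soloInformed_ends_getD_succ (by omega : s + 1 < u.length)] at hc
    omega

end labU

/-! ## 3. The insertion and merging labellings -/

section labs

variable (M : ℕ) (u : List ℕ) (m i : ℕ)

/-- `LabIns i`: `u`-blocks below `i` keep their label, `u`-blocks from `i` on are shifted by
one, the `X`-block (coordinates `≥ m+1`) gets label `i`. -/
def soloInformedLabIns (l : Fin (M + 1)) : ℕ :=
  if l.1 < m + 1 then
    (if soloInformedLabU u l < i then soloInformedLabU u l else soloInformedLabU u l + 1)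
  else i

/-- `LabMerge i`: `u`-blocks keep their label, the `X`-block joins block `i`. -/
def soloInformedLabMerge (l : Fin (M + 1)) : ℕ :=
  if l.1 < m + 1 then soloInformedLabU u l else i

/-- The `u`-prefix product `Q_t(w) = ∏_{l < J_{t+1}} w_l`. -/
def soloInformedQU (w : Fin (M + 1) → ℝ) (t : ℕ) : ℝ :=
  ∏ l ∈ Finset.univ.filter (fun l : Fin (M + 1) => l.1 < (soloInformedEnds u).getD t 0), w l

/-- The `X`-product `Y(w) = ∏_{l ≥ m+1} w_l`. -/
def soloInformedYB (w : Fin (M + 1) → ℝ) : ℝ :=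
  ∏ l ∈ Finset.univ.filter (fun l : Fin (M + 1) => m + 1 ≤ l.1), w l

variable {u m i} {a k : ℕ} (hu : MZV.IsAdmissible u) (hw : u.sum = m + 1) (hk : u.length = k + 1)
  (hM : m + a + 2 = M)
include hu hw hk hM

/-- **Fibres of `LabIns i`**: `u_t` below `i`, `a+2` at `i`, `u_{t-1}` above. -/
theorem soloInformed_fib_labIns (hi : i ≤ k + 1) {t : ℕ} (ht : t ≤ k + 1) :
    soloInformedFib (soloInformedLabIns M u m i) t =
      if h : t < i then u[t]'(by omega) else if t = i then a + 2 else u[t - 1]'(by omega) := by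
  unfold soloInformedFib
  split_ifs with h1 h2
  · rw [← soloInformed_card_fibreU hu.1 hw hk (by omega : m + 1 ≤ M + 1) (by omega : t ≤ k)]
    congr 1
    ext l
    simp only [Finset.mem_filter, Finset.mem_univ, true_and, soloInformedLabIns]
    split_ifs with h3 h4 <;> omega
  · subst h2
    have hS : Finset.univ.filter (fun l : Fin (M + 1) => soloInformedLabIns M u m t l = t) =
        Finset.univ.filter (fun l : Fin (M + 1) => m + 1 ≤ l.1) := by
      ext l
      simp only [Finset.mem_filter, Finset.mem_univ, true_and, soloInformedLabIns]
      split_ifs with h3 h4 <;> omega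
    rw [hS]
    exact soloInformed_card_filter_le_val (by omega)
  · rw [← soloInformed_card_fibreU hu.1 hw hk (by omega : m + 1 ≤ M + 1) (by omega : t - 1 ≤ k)]
    congr 1
    ext l
    simp only [Finset.mem_filter, Finset.mem_univ, true_and, soloInformedLabIns]
    split_ifs with h3 h4 <;> omega

/-- **Fibres of `LabMerge i`**: `u_t`, plus `a+2` at `t = i`. -/
theorem soloInformed_fib_labMerge (hi : i ≤ k) {t : ℕ} (ht : t ≤ k) :
    soloInformedFib (soloInformedLabMerge M u m i) t =
      if t = i then (a + 2) + u[t]'(by omega) else u[t]'(by omega) := by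
  unfold soloInformedFib
  split_ifs with h1
  · subst h1
    have hS : Finset.univ.filter (fun l : Fin (M + 1) => soloInformedLabMerge M u m t l = t) =
        Finset.univ.filter (fun l : Fin (M + 1) => m + 1 ≤ l.1) ∪
          Finset.univ.filter (fun l : Fin (M + 1) => l.1 < m + 1 ∧ soloInformedLabU u l = t) := by
      ext l
      simp only [Finset.mem_filter, Finset.mem_univ, true_and, Finset.mem_union, soloInformedLabMerge]
      split_ifs with h3 <;> omega
    rw [hS, Finset.card_union_of_disjoint (Finset.disjoint_filter.2 fun l _ h1 h2 => by omega),
      soloInformed_card_filter_le_val (show (m + 1) + (a + 2) = M + 1 by omega),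
      soloInformed_card_fibreU hu.1 hw hk (by omega : m + 1 ≤ M + 1) ht]
  · rw [← soloInformed_card_fibreU hu.1 hw hk (by omega : m + 1 ≤ M + 1) ht]
    congr 1
    ext l
    simp only [Finset.mem_filter, Finset.mem_univ, true_and, soloInformedLabMerge]
    split_ifs with h3 <;> omega

/-- `LabIns i` is a valid labelling with blocks `0,…,k+1`. -/
theorem soloInformed_isLab_labIns (hi : i ≤ k + 1) :
    soloInformedIsLab (soloInformedLabIns M u m i) (k + 1) := by
  refine ⟨fun l => ?_, fun t ht => ?_, ?_⟩
  · unfold soloInformedLabIns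
    split_ifs with h1 h2
    · have := soloInformed_labU_le hu.1 hw hk (N := M + 1) h1; omega
    · have := soloInformed_labU_le hu.1 hw hk (N := M + 1) h1; omega
    · exact hi
  · rw [soloInformed_fib_labIns M hu hw hk hM hi ht]
    split_ifs with h1 h2
    · exact hu.1 _ (List.getElem_mem _)
    · omega
    · exact hu.1 _ (List.getElem_mem _)
  · rw [soloInformed_fib_labIns M hu hw hk hM hi (Nat.zero_le _)]
    split_ifs with h1 h2
    · have h := hu.2 (List.ne_nil_of_length_eq_add_one hk)
      rwa [List.head_eq_getElem] at h
    · omega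
    · omega

/-- `LabMerge i` is a valid labelling with blocks `0,…,k`. -/
theorem soloInformed_isLab_labMerge (hi : i ≤ k) :
    soloInformedIsLab (soloInformedLabMerge M u m i) k := by
  refine ⟨fun l => ?_, fun t ht => ?_, ?_⟩
  · unfold soloInformedLabMerge
    split_ifs with h1
    · exact soloInformed_labU_le hu.1 hw hk (N := M + 1) h1
    · exact hi
  · rw [soloInformed_fib_labMerge M hu hw hk hM hi ht]
    have := hu.1 _ (List.getElem_mem (l := u) (n := t) (by omega))
    split_ifs <;> omega
  · rw [soloInformed_fib_labMerge M hu hw hk hM hi (Nat.zero_le _)]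
    have h := hu.2 (List.ne_nil_of_length_eq_add_one hk)
    rw [List.head_eq_getElem] at h
    split_ifs <;> omega

/-- **The index of `LabIns i` is `u.take i ++ (a+2) :: u.drop i`.** -/
theorem soloInformed_idx_labIns (hi : i ≤ k + 1) :
    soloInformedIdx (soloInformedLabIns M u m i) (k + 2) = u.take i ++ (a + 2) :: u.drop i := by
  apply List.ext_getElem?
  intro t
  by_cases ht : t < k + 2
  · rw [List.getElem?_eq_getElem (by simpa using ht), soloInformed_idx_getElem,
      soloInformed_fib_labIns M hu hw hk hM hi (by omega : t ≤ k + 1)]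
    split_ifs with h1 h2
    · rw [List.getElem?_append_left (by simp only [List.length_take]; omega), List.getElem?_take, if_pos h1,
        List.getElem?_eq_getElem]
    · subst h2
      rw [List.getElem?_append_right (by simp only [List.length_take]; omega)]
      simp [Nat.min_eq_left (show t ≤ u.length by omega)]
    · rw [List.getElem?_append_right (by simp only [List.length_take]; omega)]
      have e1 : t - (u.take i).length = (t - i - 1) + 1 := by simp only [List.length_take]; omega
      rw [e1, List.getElem?_cons_succ, List.getElem?_drop, List.getElem?_eq_getElem (by omega)]
      congr 2
      omega
  · rw [List.getElem?_eq_none (by simpa using ht), List.getElem?_eq_none (by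
      simp only [List.length_append, List.length_cons, List.length_take, List.length_drop]; omega)]

/-- **The index of `LabMerge i` is `u.take i ++ ((a+2) + u_i) :: u.drop (i+1)`.** -/
theorem soloInformed_idx_labMerge (hi : i ≤ k) :
    soloInformedIdx (soloInformedLabMerge M u m i) (k + 1) =
      u.take i ++ ((a + 2) + u[i]'(by omega)) :: u.drop (i + 1) := by
  apply List.ext_getElem?
  intro t
  by_cases ht : t < k + 1
  · rw [List.getElem?_eq_getElem (by simpa using ht), soloInformed_idx_getElem,
      soloInformed_fib_labMerge M hu hw hk hM hi (by omega : t ≤ k)]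
    split_ifs with h1
    · subst h1
      rw [List.getElem?_append_right (by simp only [List.length_take]; omega)]
      simp [Nat.min_eq_left (show t ≤ u.length by omega)]
    · rcases lt_or_gt_of_ne h1 with h2 | h2
      · rw [List.getElem?_append_left (by simp only [List.length_take]; omega), List.getElem?_take, if_pos h2,
          List.getElem?_eq_getElem]
      · rw [List.getElem?_append_right (by simp only [List.length_take]; omega)]
        have e1 : t - (u.take i).length = (t - i - 1) + 1 := by simp only [List.length_take]; omega
        rw [e1, List.getElem?_cons_succ, List.getElem?_drop, List.getElem?_eq_getElem (by omega)]
        congr 2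
        omega
  · rw [List.getElem?_eq_none (by simpa using ht), List.getElem?_eq_none (by
      simp only [List.length_append, List.length_cons, List.length_take, List.length_drop]; omega)]

/-! ## 4. Chain products of the two labellings -/

/-- **Chain products of `LabIns i`**: `Q_t` below `i`; `Q_{t-1}·Y` (with `Q_{-1} = 1`) from
`i` on. -/
theorem soloInformed_BP_labIns (hi : i ≤ k + 1) (w : Fin (M + 1) → ℝ) {t : ℕ} (ht : t ≤ k + 1) :
    soloInformedBP (soloInformedLabIns M u m i) w t =
      if t < i then soloInformedQU M u w t
      else (if t = 0 then 1 else soloInformedQU M u w (t - 1)) * soloInformedYB M m w := by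
  unfold soloInformedBP
  split_ifs with h1 h2
  · rw [soloInformedQU, ← soloInformed_filter_labU_le hu.1 hw hk (by omega : t ≤ k)]
    congr 1
    ext l
    simp only [Finset.mem_filter, Finset.mem_univ, true_and, soloInformedLabIns]
    split_ifs with h3 h4 <;> omega
  · subst h2
    rw [one_mul, soloInformedYB]
    congr 1
    ext l
    simp only [Finset.mem_filter, Finset.mem_univ, true_and, soloInformedLabIns]
    split_ifs with h3 h4 <;> omega
  · rw [soloInformedQU, soloInformedYB, ← Finset.prod_union (Finset.disjoint_filter.2
      fun l _ h3 h4 => by have := soloInformed_ends_getD_le_weight hu.1 hw hk (t - 1); omega)]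
    congr 1
    ext l
    simp only [Finset.mem_filter, Finset.mem_univ, true_and, Finset.mem_union, soloInformedLabIns]
    have key : l.1 < m + 1 → (soloInformedLabU u l < t ↔ l.1 < (soloInformedEnds u).getD (t - 1) 0) :=
      fun hl => by
        have := soloInformed_labU_le_iff hu.1 hw hk (N := M + 1) hl (t := t - 1) (by omega)
        omega
    have hle := soloInformed_ends_getD_le_weight hu.1 hw hk (t - 1)
    split_ifs with h3 h4
    · constructor
      · intro; exact Or.inl ((key h3).1 (by omega))
      · rintro (h | h)
        · omega
        · omega
    · constructor
      · intro h; exact Or.inl ((key h3).1 (by omega))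
      · rintro (h | h)
        · have := (key h3).2 h; omega
        · omega
    · constructor
      · intro; exact Or.inr (by omega)
      · intro; omega

/-- **Chain products of `LabMerge i`**: `Q_t`, times `Y` from `i` on. -/
theorem soloInformed_BP_labMerge (w : Fin (M + 1) → ℝ) {t : ℕ} (ht : t ≤ k) :
    soloInformedBP (soloInformedLabMerge M u m i) w t =
      if t < i then soloInformedQU M u w t else soloInformedQU M u w t * soloInformedYB M m w := by
  unfold soloInformedBP
  split_ifs with h1
  · rw [soloInformedQU, ← soloInformed_filter_labU_le hu.1 hw hk ht]
    congr 1
    ext l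
    simp only [Finset.mem_filter, Finset.mem_univ, true_and, soloInformedLabMerge]
    split_ifs with h3 <;> omega
  · rw [soloInformedQU, soloInformedYB, ← soloInformed_filter_labU_le hu.1 hw hk ht,
      ← Finset.prod_union (Finset.disjoint_filter.2 fun l _ h3 h4 => by omega)]
    congr 1
    ext l
    simp only [Finset.mem_filter, Finset.mem_univ, true_and, Finset.mem_union, soloInformedLabMerge]
    split_ifs with h3 <;> omega

end labs

end Summit.KontsevichZagierPeriods.KontsevichZagierPeriods.Theorems
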